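import Mathlib
import Literature.Barriers.ValiantsHypothesis.AlgebraicNaturalProofs
import Literature.Computability.AlgebraicComplexity.KRSTSelection
import Summits.ValiantsHypothesis.ValiantsHypothesis.Theorems.BarrierLeverSuccinctHittingSetsForVPPolyParametrization
import Summits.ValiantsHypothesis.ValiantsHypothesis.Theorems.BarrierLeverNaturalProofsSeparateVNPSignSliceIntVec
import Summits.ValiantsHypothesis.ValiantsHypothesis.Theorems.BarrierLeverNaturalProofsSeparateVNPSignSliceZeroPatterns
import HarnessLib

/-!
# Item `BarrierLever.NaturalProofsSeparateVNP` (stmt-ValiantsHypothesis-18972), SIGN SLICE —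
# part 3: ONE integer point hits every sign polynomial with a small circuit; a Siegel witness

Support file for the unconditional SIGN-SLICE form of the item (CKRST 2020, Thm. 1.1, tree frame).
CKRST use the (non-explicit) Heintz–Schnorr hitting sets `𝓗 ⊂ [B]^n`, `|𝓗| = poly`, for ALL
size-`s` circuits; here the class to be hit is only `SmallCircuits ℂ n b ∩ signCoeffSlice ℂ n`, a
FINITE set whose size is bounded by the zero-pattern count of part 1 applied to the tree's Raz
parametrisation of `SmallCircuits ℂ n b` (`SuccinctHittingSetsForVP.exists_parametrization`: `p ≤
9376 (n+4)^(5b+21)` parameters, degree `≤ 2n`), so a Schwartz–Zippel union bound yields a hitting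
set consisting of ONE point of `[1, B]^n`, `B = hitBound n b` (exponentially large coordinates —
harmless after Chinese remaindering, part 4).

* `SignSlice.hitBound n b = (4 n (n+1)^n + 1)^(9376 (n+4)^(5b+21)) · n + 1`;
* `SignSlice.exists_hitting_point` — for `n ≥ 1` some `a ∈ [1, hitBound n b]^n` has `f(a) ≠ 0` for
  every nonzero `f ∈ SmallCircuits ℂ n b ∩ signCoeffSlice ℂ n`;
* `SignSlice.exists_witness` — (Siegel's lemma, pigeonhole form) if `N · B^n + 1 < 2^N`,
  `N = #degLEMonomials n`, then for every `a ∈ [0, B]^n` some nonzero `{0,1,-1}`-vector `e` has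
  `∑_m e_m a^m = 0`.

References: [ChatterjeeKumarRamyaSaptharishiTengse2020] §4 (Lemma 12 [HS80] replaced as explained;
"remark on the largeness" = Siegel's lemma [S14a]); [ForbesShpilkaVolk2018] §3; [Raz2010] Prop. 3.3.
-/

-- layout Summits/ValiantsHypothesis/ValiantsHypothesis forces the duplicated namespace component
set_option linter.dupNamespace false

noncomputable section

namespace Summit.ValiantsHypothesis.ValiantsHypothesis.Theorems.BarrierLever.NaturalProofsSeparateVNP

open Literature.Barriers.ValiantsHypothesis Literature.Computability.AlgebraicComplexity MvPolynomial
open Summit.ValiantsHypothesis.ValiantsHypothesis.Theorems.BarrierLever.SuccinctHittingSetsForVP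

namespace SignSlice

/-! ### Schwartz–Zippel in counting form -/

/-- Schwartz–Zippel, counting form: a nonzero `g` of total degree `≤ d` vanishes at no more than a
`d / #S` fraction of the grid `S^n`: `#{x ∈ S^n : g(x) = 0} · #S ≤ d · #S^n`. [folklore] -/
theorem card_zeros_mul_le {n : ℕ} {g : MvPolynomial (Fin n) ℂ} (hg : g ≠ 0) {d : ℕ}
    (hd : g.totalDegree ≤ d) (S : Finset ℂ) (hS : S.Nonempty) :
    ((Fintype.piFinset fun _ : Fin n => S).filter (fun x => eval x g = 0)).card * S.card ≤
      d * S.card ^ n := by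
  classical
  have h := MvPolynomial.schwartz_zippel_totalDegree hg S
  have hSpos : (0 : ℚ≥0) < S.card := by exact_mod_cast hS.card_pos
  have hSn : (0 : ℚ≥0) < (S.card : ℚ≥0) ^ n := pow_pos hSpos n
  rw [div_le_div_iff₀ hSn hSpos] at h
  have h' : (((Fintype.piFinset fun _ : Fin n => S).filter (fun x => eval x g = 0)).card : ℚ≥0) *
      S.card ≤ (d : ℚ≥0) * (S.card : ℚ≥0) ^ n :=
    h.trans (by have hd' : (g.totalDegree : ℚ≥0) ≤ d := by exact_mod_cast hd
                gcongr)
  exact_mod_cast h'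

/-! ### The hitting point -/

/-- The coordinate bound of the hitting point: `B = Z · n + 1` with
`Z = (4 n (n+1)^n + 1)^(9376 (n+4)^(5b+21))` the zero-pattern bound for the Raz parametrisation
(using the crude count `#degLEMonomials n ≤ (n+1)^n`, tree `card_degLEMonomials_le`).
[cite: ChatterjeeKumarRamyaSaptharishiTengse2020, §4] -/
def hitBound (n b : ℕ) : ℕ :=
  (4 * n * (n + 1) ^ n + 1) ^ (9376 * (n + 4) ^ (5 * b + 21)) * n + 1

/-- `hitBound n b ≥ 1`. [folklore] -/
theorem one_le_hitBound (n b : ℕ) : 1 ≤ hitBound n b := Nat.le_add_left 1 _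

/-- **One point hits every sign polynomial with a small circuit.** For `n ≥ 1` there is
`a ∈ [1, hitBound n b]^n` with `f(a) ≠ 0` for every nonzero `f ∈ SmallCircuits ℂ n b` with
coefficients in `{0, 1, -1}`. [cite: ChatterjeeKumarRamyaSaptharishiTengse2020, Lemma 12 and §4] -/
theorem exists_hitting_point (b : ℕ) {n : ℕ} (hn : 1 ≤ n) :
    ∃ a : Fin n → ℕ, (∀ i, 1 ≤ a i ∧ a i ≤ hitBound n b) ∧
      ∀ f ∈ SmallCircuits ℂ n b, f ∈ signCoeffSlice ℂ n → f ≠ 0 →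
        eval (fun i => (a i : ℂ)) f ≠ 0 := by
  classical
  obtain ⟨p, G, hp, hdeg, hG⟩ := exists_parametrization b n hn
  set N := Fintype.card (degLEMonomials n) with hN
  -- the finite class to be hit
  let vecs : Finset (degLEMonomials n → ℤ) := Fintype.piFinset fun _ => ({0, 1, -1} : Finset ℤ)
  let T : Finset (MvPolynomial (Fin n) ℂ) :=
    (vecs.image ofIntVec).filter (fun f => f ∈ SmallCircuits ℂ n b ∧ f ≠ 0)
  have hvecs : ∀ e, e ∈ vecs ↔ ∀ m, e m = 0 ∨ e m = 1 ∨ e m = -1 := by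
    intro e; simp [vecs, Fintype.mem_piFinset]
  have hTmem : ∀ f ∈ SmallCircuits ℂ n b, f ∈ signCoeffSlice ℂ n → f ≠ 0 → f ∈ T := by
    intro f hf hs h0
    refine Finset.mem_filter.mpr ⟨Finset.mem_image.mpr ⟨sgnVec f, (hvecs _).mpr (sgnVec_mem f),
      ofIntVec_sgnVec hs hf.1⟩, hf, h0⟩
  have hTvec : ∀ f ∈ T, ∃ e, (∀ m, e m = 0 ∨ e m = 1 ∨ e m = -1) ∧ f = ofIntVec e := by
    intro f hf
    obtain ⟨e, he, rfl⟩ := Finset.mem_image.mp (Finset.mem_filter.mp hf).1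
    exact ⟨e, (hvecs e).mp he, rfl⟩
  -- its size, by the zero-pattern count
  have hTcard : T.card ≤ (2 * N * (2 * n) + 1) ^ p := by
    have hinj : Set.InjOn (coeffVector (degLEMonomials n)) (T : Set (MvPolynomial (Fin n) ℂ)) := by
      intro f hf g hg hfg
      obtain ⟨e, -, rfl⟩ := hTvec f hf
      obtain ⟨e', -, rfl⟩ := hTvec g hg
      rw [coeffVector_ofIntVec, coeffVector_ofIntVec] at hfg
      have : e = e' := funext fun m => by exact_mod_cast congrFun hfg m
      rw [this]
    rw [← Finset.card_image_of_injOn hinj]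
    refine ZeroPatterns.card_le_of_signVectors_mem_image G hdeg _ ?_ ?_
    · intro c hc m
      obtain ⟨f, hf, rfl⟩ := Finset.mem_image.mp hc
      obtain ⟨e, he, rfl⟩ := hTvec f hf
      rw [coeffVector_ofIntVec]
      rcases he m with h | h | h <;> simp [h]
    · intro c hc
      obtain ⟨f, hf, rfl⟩ := Finset.mem_image.mp hc
      obtain ⟨y, hy⟩ := hG f (Finset.mem_filter.mp hf).2.1
      exact ⟨y, fun m => by rw [hy m, coeffVector_apply]⟩
  -- the explicit bound
  set Z := (4 * n * (n + 1) ^ n + 1) ^ (9376 * (n + 4) ^ (5 * b + 21)) with hZ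
  have hTZ : T.card ≤ Z := by
    refine hTcard.trans ?_
    calc (2 * N * (2 * n) + 1) ^ p ≤ (4 * n * (n + 1) ^ n + 1) ^ p := by
          apply Nat.pow_le_pow_left
          have := card_degLEMonomials_le n
          nlinarith
      _ ≤ Z := Nat.pow_le_pow_right (Nat.succ_pos _) hp
  set B := Z * n + 1 with hB
  have hBdef : hitBound n b = B := rfl
  have hB1 : 1 ≤ B := Nat.le_add_left 1 _
  -- the grid `[1, B]^n` inside `ℂ^n`
  let Sg : Finset ℂ := (Finset.Icc 1 B).image (fun k : ℕ => (k : ℂ))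
  have hSg_card : Sg.card = B := by
    rw [Finset.card_image_of_injective _ Nat.cast_injective, Nat.card_Icc]; omega
  have hSg_ne : Sg.Nonempty := by
    rw [← Finset.card_pos, hSg_card]; exact hB1
  let grid : Finset (Fin n → ℂ) := Fintype.piFinset fun _ : Fin n => Sg
  let bad : MvPolynomial (Fin n) ℂ → Finset (Fin n → ℂ) := fun f =>
    grid.filter (fun x => eval x f = 0)
  have hbad : ∀ f ∈ T, (bad f).card * B ≤ n * B ^ n := by
    intro f hf
    obtain ⟨e, -, rfl⟩ := hTvec f hf
    have h0 : ofIntVec e ≠ 0 := (Finset.mem_filter.mp hf).2.2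
    have := card_zeros_mul_le h0 (totalDegree_ofIntVec_le e) Sg hSg_ne
    rwa [hSg_card] at this
  let allbad : Finset (Fin n → ℂ) := T.biUnion bad
  have hallbad : allbad.card < grid.card := by
    have hgrid : grid.card = B ^ n := by
      simp [grid, Fintype.card_piFinset, hSg_card]
    rw [hgrid]
    have h1 : allbad.card * B ≤ T.card * (n * B ^ n) := by
      calc allbad.card * B ≤ (∑ f ∈ T, (bad f).card) * B :=
            Nat.mul_le_mul_right _ (Finset.card_biUnion_le)
        _ = ∑ f ∈ T, (bad f).card * B := Finset.sum_mul _ _ _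
        _ ≤ ∑ _f ∈ T, n * B ^ n := Finset.sum_le_sum hbad
        _ = T.card * (n * B ^ n) := by rw [Finset.sum_const, smul_eq_mul]
    have h2 : T.card * (n * B ^ n) ≤ (Z * n) * B ^ n := by
      rw [← mul_assoc]; exact Nat.mul_le_mul_right _ (Nat.mul_le_mul_right _ hTZ)
    have h3 : Z * n < B := by omega
    by_contra hge
    push Not at hge
    have hBn : 0 < B ^ n := pow_pos (by omega) n
    have : B * B ^ n ≤ (Z * n) * B ^ n :=
      calc B * B ^ n ≤ allbad.card * B := by rw [mul_comm]; exact Nat.mul_le_mul_right _ hge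
        _ ≤ (Z * n) * B ^ n := h1.trans h2
    have := Nat.le_of_mul_le_mul_right this hBn
    omega
  obtain ⟨x, hxg, hxa⟩ := Finset.exists_mem_notMem_of_card_lt_card hallbad
  -- read off the integer coordinates
  have hxi : ∀ i, ∃ k : ℕ, (1 ≤ k ∧ k ≤ B) ∧ (k : ℂ) = x i := by
    intro i
    have := Fintype.mem_piFinset.mp hxg i
    obtain ⟨k, hk, hkx⟩ := Finset.mem_image.mp this
    exact ⟨k, Finset.mem_Icc.mp hk, hkx⟩
  choose a ha hax using hxi
  have hxeq : (fun i => (a i : ℂ)) = x := funext hax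
  refine ⟨a, fun i => hBdef ▸ ha i, fun f hf hs h0 => ?_⟩
  rw [hxeq]
  intro hzero
  exact hxa (Finset.mem_biUnion.mpr ⟨f, hTmem f hf hs h0, Finset.mem_filter.mpr ⟨hxg, hzero⟩⟩)

/-! ### The Siegel witness -/

/-- **Siegel's lemma, pigeonhole form.** If `N · B^n + 1 < 2^N` (`N = #degLEMonomials n`) and
`a ∈ [0, B]^n`, `B ≥ 1`, then some NONZERO vector `e ∈ {0,1,-1}^N` has `∑_m e_m a^m = 0`: two of
the `2^N` subset sums of the `N` numbers `a^m ∈ [0, B^n]` coincide.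
[cite: ChatterjeeKumarRamyaSaptharishiTengse2020, §4 (remark on the largeness)] -/
theorem exists_witness {n : ℕ} (a : Fin n → ℕ) {B : ℕ} (hB : 1 ≤ B) (ha : ∀ i, a i ≤ B)
    (hlt : Fintype.card (degLEMonomials n) * B ^ n + 1 < 2 ^ Fintype.card (degLEMonomials n)) :
    ∃ e : degLEMonomials n → ℤ, e ≠ 0 ∧ (∀ m, e m = 0 ∨ e m = 1 ∨ e m = -1) ∧ intEval a e = 0 := by
  classical
  set N := Fintype.card (degLEMonomials n) with hN
  let natEval : (degLEMonomials n → Fin 2) → ℕ := fun u => ∑ m, (u m : ℕ) * monoVal a m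
  have hle : ∀ u, natEval u ≤ N * B ^ n := by
    intro u
    calc natEval u = ∑ m, (u m : ℕ) * monoVal a m := rfl
      _ ≤ ∑ _m : degLEMonomials n, B ^ n := Finset.sum_le_sum fun m _ => by
          calc (u m : ℕ) * monoVal a m ≤ 1 * B ^ n :=
                Nat.mul_le_mul (by have := (u m).isLt; omega) (monoVal_le_pow hB ha m)
            _ = B ^ n := one_mul _
      _ = N * B ^ n := by rw [Finset.sum_const, smul_eq_mul, Finset.card_univ]
  have hmaps : ∀ u ∈ (Finset.univ : Finset (degLEMonomials n → Fin 2)),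
      natEval u ∈ Finset.range (N * B ^ n + 1) :=
    fun u _ => Finset.mem_range.mpr (Nat.lt_succ_of_le (hle u))
  have hcard : (Finset.range (N * B ^ n + 1)).card <
      (Finset.univ : Finset (degLEMonomials n → Fin 2)).card := by
    rw [Finset.card_range, Finset.card_univ, Fintype.card_fun, Fintype.card_fin]
    exact hlt
  obtain ⟨u, -, u', -, hne, heq⟩ := Finset.exists_ne_map_eq_of_card_lt_of_maps_to hcard hmaps
  refine ⟨fun m => (u m : ℕ) - (u' m : ℕ), ?_, ?_, ?_⟩
  · intro h0
    apply hne
    funext m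
    have := congrFun h0 m
    simp only [Pi.zero_apply, sub_eq_zero, Nat.cast_inj] at this
    exact Fin.ext this
  · intro m
    have h1 := (u m).isLt
    have h2 := (u' m).isLt
    interval_cases hu : (u m : ℕ) <;> interval_cases hu' : (u' m : ℕ) <;> simp [hu, hu']
  · have h : (natEval u : ℤ) = natEval u' := by exact_mod_cast heq
    simp only [intEval, sub_mul, Finset.sum_sub_distrib]
    simp only [natEval] at h
    push_cast at h
    linear_combination h

end SignSlice

end Summit.ValiantsHypothesis.ValiantsHypothesis.Theorems.BarrierLever.NaturalProofsSeparateVNP
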